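import Summits.HodgeConjecture.CorCM.DecicCurveFivefoldFrameTransfer
import Summits.HodgeConjecture.CorCM.CMWeightDistribution
import Summits.HodgeConjecture.CorCM.CMWeightLinesDisjointUnion
import Summits.HodgeConjecture.CorCM.Model.CMSliceOfWeilFaces
import HarnessLib

/-!
# COR-CM — the Hodge conjecture for ALL PRODUCTS OF COPIES `B₀^a × E^c` of the half-circle CM fivefold of a cyclic
# decic CM field `F ⊃ k` and the CM curve of `k`, GIVEN the Weil plane of the sixfold `B₀ × E`: assembly for the powers

Cell `pub-hodgecm2` (COR-CM), seat b09 gen 18 (2026-08-21); count-neutral own lane DECIC-EB0 (lit-andre-3's prover-lane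
ask A6-R22); theorems only, no definition, no named fact, no `sorry`.  Sequel of `CorCM/DecicCurveFivefoldFrameTransfer.lean`
(frame transfer §1, generators §2; setting and notation as there), in the pattern of seat b30's
`CorCM/DihedralSexticPairCurvePowersTransfer.lean`:

* `exists_weightClassesAlg_le_algebraicClasses_of_part` — a generating part of a weight of `X = ⨁_j A₂(κ j)` has an
  algebraic line: its projection is a weight of `Y = ⨁ A₂` with the same model image (conjugate pair: divisor; Weil `6`-set:
  the hypothesis `hweil6`), and seat b30's DISTRIBUTION LEMMA `CMWeights.weightClassesAlg_comp_le_algebraicClasses_of_injOn`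
  lifts it along `κ`;
* `hodgeConjectureFor_biproduct_comp_of_generators` — Pohlmann's theorem for the CM algebra `∏_j K_{κ j}`, frame transfer,
  the induction principle `modelBalanced_induction` of `Census/DecicCurveFivefoldPowers.lean`, and the multiplicativity of
  algebraic weight lines (`PairWeights.weightClassesAlg_union_le_algebraicClasses`);
* **`hodgeConjectureFor_biproduct_comp_of_weilPlane`** — `HodgeConjectureFor (⨁_j A₂ (κ j))` for EVERY `κ`, i.e. for
  `B₀^a × E^c`, all `a, c`, any order, GIVEN ONLY `hW` (the Weil plane of `(B₀ × E, ι_B(iδ) × ι_E(δ))` consists of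
  algebraic classes); with the `AVDominatedBy` form (isogeny factors of powers).
HONEST FRAMING: conditional on the displayed Weil-plane hypothesis `hW` (Markman's realm: arXiv:2502.03415 Thm 1.5.1
proves it for the SPLIT polarisations, and ring 2's `Ring2.AbelianAll.isSplitWeilType_odd_prod_curve` shows that
`B₀ × E` — an ODD-dimensional factor times a curve — always carries a split polarisation; `CorCM/DecicCurveFivefoldWeilAiming.lean`
assembles these, `CorCM/DecicCurveFivefoldHodgeOfMarkman.lean` concludes); `HC_CM` is not asserted; no case of the Hodge
conjecture is claimed unconditionally here.
[cite: Pohlmann1968, Thm 1] [cite: GaoUllmo2025, Thm 3.1] [cite: Milne2020HodgeClassesAV, 1.2 (a) and Thm. 1]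
[cite: Deligne1982HodgeCycles, §4–§5] [cite: MumfordAV1970, §19]

## References
* [Pohlmann1968] H. Pohlmann, Ann. of Math. 88 (1968), Thm 1.  [GaoUllmo2025] Z. Gao, E. Ullmo, J. Inst. Math. Jussieu 25
  (2025), Thm 3.1.  [Milne2020HodgeClassesAV] J. S. Milne, arXiv:2010.08857, 1.2 (a), Thm. 1.  [Deligne1982HodgeCycles]
  P. Deligne, LNM 900 (1982), §4 Prop. 4.4, §5 (c).  [Markman2025SecantWeil] E. Markman, arXiv:2502.03415, Thm 1.5.1.
  [MumfordAV1970] D. Mumford, *Abelian Varieties*, §19.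
-/

noncomputable section

open CategoryTheory CategoryTheory.Limits NumberField

namespace Summit.HodgeConjecture.CorCM.DecicCurveFivefold

open Literature.AlgebraicGeometry Literature.AlgebraicGeometry.Motives Literature.AlgebraicGeometry.HodgeTheory
open Literature.AlgebraicGeometry.ComplexMultiplication (IsCMTypeRealisation)
open Literature.AlgebraicGeometry.Pohlmann1968
open Literature.AlgebraicTopology.SingularHomology
open Literature.NumberTheory.ComplexMultiplication
open Summit.HodgeConjecture.CorCM.Census.DecicCurveFivefold (Pt act phi balanced conjPair weil6 gens mem_gens_iff
  gens_balanced)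
open Summit.HodgeConjecture.CorCM.Census.DecicCurveFivefoldPowers (ModelBalanced modelBalanced_induction)
open Summit.HodgeConjecture.CorCM.PairWeights
open Summit.HodgeConjecture.CorCM.CMWeights (weightClassesAlg_comp_le_algebraicClasses_of_injOn)

open scoped Classical Pointwise


/-! ## §3 Assembly for the powers -/

section Assembly

variable {I : Type} {Kf : I → Type} [∀ i, Field (Kf i)] [∀ i, NumberField (Kf i)] [∀ i, IsCMField (Kf i)]
  {i₀ i₁ : I} {N : ℕ} (κ : Fin N → Fin 2) {e : (Kf i₁ →+* ℂ) ≃ ZMod 10} {τ : Kf i₀ →+* ℂ} {i : Kf i₀ →+* Kf i₁}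
  {A₂ : Fin 2 → AbelianVariety ℂ} {Φ₂ : ∀ j : Fin 2, CMType (Kf (curveSlots₂ i₀ i₁ j))}
  {ι₂ : ∀ j, 𝓞 (Kf (curveSlots₂ i₀ i₁ j)) →+* End (A₂ j)}
  {θ₂ : ∀ j, Kf (curveSlots₂ i₀ i₁ j) →+* Module.End ℂ (complexBetti (A₂ j).X 1)}

/-- **A generating part of a weight of `X = ⨁_j A₂(κ j)` has an algebraic weight line.**  If `v = toPt ∘ P` is injective
on `G` and `v(G)` is `conjPair y` or `weil6 b`, then `G` has `2q` elements (`q = 1, 3`) and `H^{2q}(X)_G ⊆ N^q`: the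
projected weight `P(G)` of `Y = ⨁ A₂` has the same model image, hence an algebraic line on `Y` (divisor pair, resp. the
hypothesis `hweil6`), and seat b30's distribution lemma lifts it along `κ`.
[cite: Milne2020HodgeClassesAV, 1.2 (a) and Thm. 1] -/
theorem exists_weightClassesAlg_le_algebraicClasses_of_part
    (hττ : ComplexEmbedding.conjugate τ ≠ τ) (hk : ∀ σ : Kf i₀ →+* ℂ, σ = τ ∨ σ = ComplexEmbedding.conjugate τ)
    (he_conj : ∀ s : Kf i₁ →+* ℂ, e (ComplexEmbedding.conjugate s) = e s + 5)
    (hA : ∀ j, IsCMTypeRealisation (Φ₂ j) (A₂ j) (ι₂ j) (θ₂ j))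
    (hweil6 : ∀ (b : Bool) (T : Finset ((j : Fin 2) × (Kf (curveSlots₂ i₀ i₁ j) →+* ℂ))),
      T.image (toPt e τ) = weil6 b → weightClassesAlg A₂ ι₂ (2 * 3) T ≤ algebraicClasses (⨁ A₂).X 3)
    {G : Finset ((j : Fin N) × (Kf (curveSlots₂ i₀ i₁ (κ j)) →+* ℂ))}
    (hinj : Set.InjOn (fun x => toPt e τ ((Sigma.map κ (fun _ => id) :
      ((j : Fin N) × (Kf (curveSlots₂ i₀ i₁ (κ j)) →+* ℂ)) → ((m : Fin 2) × (Kf (curveSlots₂ i₀ i₁ m) →+* ℂ))) x)) ↑G)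
    (hG : G.image (fun x => toPt e τ ((Sigma.map κ (fun _ => id) :
      ((j : Fin N) × (Kf (curveSlots₂ i₀ i₁ (κ j)) →+* ℂ)) → ((m : Fin 2) × (Kf (curveSlots₂ i₀ i₁ m) →+* ℂ))) x))
        ∈ gens) :
    ∃ q : ℕ, G.card = 2 * q ∧ weightClassesAlg (fun j => A₂ (κ j)) (fun j => ι₂ (κ j)) (2 * q) G ≤
      algebraicClasses (⨁ fun j => A₂ (κ j)).X q := by
  set P : ((j : Fin N) × (Kf (curveSlots₂ i₀ i₁ (κ j)) →+* ℂ)) → ((m : Fin 2) × (Kf (curveSlots₂ i₀ i₁ m) →+* ℂ)) :=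
    Sigma.map κ (fun _ => id) with hP
  have hPinj : Set.InjOn P ↑G := fun x hx y hy h => hinj hx hy (by simp only [h])
  set TY : Finset ((m : Fin 2) × (Kf (curveSlots₂ i₀ i₁ m) →+* ℂ)) := G.image P with hTY
  have hTYimg : TY.image (toPt e τ) = G.image (fun x => toPt e τ (P x)) := by rw [hTY, Finset.image_image]; rfl
  have hTYcard : TY.card = G.card := Finset.card_image_of_injOn hPinj
  have hGcard_img : G.card = (G.image fun x => toPt e τ (P x)).card := (Finset.card_image_of_injOn hinj).symm
  -- the projected weight is algebraic on `Y`, of the right size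
  obtain ⟨q, hq, hYalg⟩ : ∃ q, G.card = 2 * q ∧ weightClassesAlg A₂ ι₂ (2 * q) TY ≤ algebraicClasses (⨁ A₂).X q := by
    rcases (mem_gens_iff _).1 hG with ⟨y, hy⟩ | hy | hy
    · obtain ⟨hc, halg⟩ := weightClassesAlg_le_algebraicClasses_of_image_eq_conjPair hττ hk he_conj hA
        (T := TY) (y := y) (by rw [hTYimg, hy])
      exact ⟨1, by rw [← hTYcard, hc], halg⟩
    · refine ⟨3, ?_, hweil6 true TY (by rw [hTYimg, hy])⟩
      rw [hGcard_img, hy]; exact (gens_balanced.2 true).2.1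
    · refine ⟨3, ?_, hweil6 false TY (by rw [hTYimg, hy])⟩
      rw [hGcard_img, hy]; exact (gens_balanced.2 false).2.1
  -- the distribution lemma lifts it to `X`
  exact ⟨q, hq, weightClassesAlg_comp_le_algebraicClasses_of_injOn (K := fun m => Kf (curveSlots₂ i₀ i₁ m)) hA κ hq
    hPinj hYalg⟩

/-- **`HodgeConjectureFor (⨁_j A₂ (κ j))` from the frame and the `weil6` hypothesis on `Y = ⨁ A₂`** (any slot map `κ`):
every rational `(p,p)`-class of the power is algebraic.  Pohlmann's theorem for the CM algebra `∏_j K_{κ j}`, frame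
transfer (§1), the induction principle for balanced configurations (`Census/DecicCurveFivefoldPowers.lean`), the lift
of generating parts, and the multiplicativity of algebraic weight lines (`PairWeights.weightClassesAlg_union_le_algebraicClasses`).
[cite: Pohlmann1968, Thm 1] [cite: GaoUllmo2025, Thm 3.1] [cite: Milne2020HodgeClassesAV, 1.2 (a) and Thm. 1] -/
theorem hodgeConjectureFor_biproduct_comp_of_generators
    (hττ : ComplexEmbedding.conjugate τ ≠ τ) (hk : ∀ σ : Kf i₀ →+* ℂ, σ = τ ∨ σ = ComplexEmbedding.conjugate τ)
    (hA : ∀ j, IsCMTypeRealisation (Φ₂ j) (A₂ j) (ι₂ j) (θ₂ j))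
    (he_sign : ∀ s : Kf i₁ →+* ℂ, s.comp i = τ ↔ (e s).val % 2 = 1)
    (he_conj : ∀ s : Kf i₁ →+* ℂ, e (ComplexEmbedding.conjugate s) = e s + 5)
    (he_gal : ∀ g : ZMod 10, ∃ ρ : ℂ ≃+* ℂ, ∀ s : Kf i₁ →+* ℂ, e ((ρ : ℂ →+* ℂ).comp s) = e s + g)
    (hΦ : ∀ s : Kf i₁ →+* ℂ, s ∈ (Φ₂ 0).1 ↔ (e s).val < 5)
    (hΨ : ∀ σ : Kf i₀ →+* ℂ, σ ∈ (Φ₂ (0 : Fin 1).succ).1 ↔ σ = τ)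
    (hweil6 : ∀ (b : Bool) (T : Finset ((j : Fin 2) × (Kf (curveSlots₂ i₀ i₁ j) →+* ℂ))),
      T.image (toPt e τ) = weil6 b → weightClassesAlg A₂ ι₂ (2 * 3) T ≤ algebraicClasses (⨁ A₂).X 3) :
    HodgeConjectureFor (⨁ fun j => A₂ (κ j)).dim (⨁ fun j => A₂ (κ j)).X := by
  refine ⟨nonempty_hodgeModel_holds (Motives.AbelianVariety.isSmoothProjective_holds (A := ⨁ fun j => A₂ (κ j))),
    fun p c hc hH => ?_⟩
  have hAκ : ∀ j, IsCMTypeRealisation (Φ₂ (κ j)) (A₂ (κ j)) (ι₂ (κ j)) (θ₂ (κ j)) := fun j => hA (κ j)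
  -- every balanced configuration has algebraic weight lines: induct over its generating parts
  have key : ∀ (R : Finset ((j : Fin N) × (Kf (curveSlots₂ i₀ i₁ (κ j)) →+* ℂ))),
      ModelBalanced (fun x => toPt e τ ((Sigma.map κ (fun _ => id) :
        ((j : Fin N) × (Kf (curveSlots₂ i₀ i₁ (κ j)) →+* ℂ)) → ((m : Fin 2) × (Kf (curveSlots₂ i₀ i₁ m) →+* ℂ))) x)) R →
      ∀ q, R.card = 2 * q → weightClassesAlg (fun j => A₂ (κ j)) (fun j => ι₂ (κ j)) (2 * q) R ≤
        algebraicClasses (⨁ fun j => A₂ (κ j)).X q := by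
    intro R hR
    refine modelBalanced_induction (motive := fun R => ∀ q, R.card = 2 * q →
      weightClassesAlg (fun j => A₂ (κ j)) (fun j => ι₂ (κ j)) (2 * q) R ≤ algebraicClasses (⨁ fun j => A₂ (κ j)).X q)
      (fun q hq => ?_) (fun G R hGR hinj hG ih q hq => ?_) hR
    · obtain rfl : q = 0 := by simpa using hq.symm
      exact fun c _ => hodgeConjectureFor_codim_zero c
    · obtain ⟨a, ha, hGalg⟩ :=
        exists_weightClassesAlg_le_algebraicClasses_of_part κ hττ hk he_conj hA hweil6 hinj hG
      have hRcard : R.card = 2 * (q - a) := by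
        have h := Finset.card_union_of_disjoint hGR
        rw [hq, ha] at h
        omega
      have haq : a + (q - a) = q := by
        have h := Finset.card_union_of_disjoint hGR
        rw [hq, ha] at h
        omega
      rw [← Finset.disjUnion_eq_union G R hGR]
      exact weightClassesAlg_union_le_algebraicClasses hAκ haq ha hRcard hGR hGalg (ih (q - a) hRcard)
  have hmem : c ∈ ⨆ S ∈ pohlmannSetsAlg (K := fun j => Kf (curveSlots₂ i₀ i₁ (κ j))) (fun j => Φ₂ (κ j)) p,
      weightClassesAlg (fun j => A₂ (κ j)) (fun j => ι₂ (κ j)) (2 * p) S := by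
    rw [← (Pohlmann1968_thm1_cmAlgebra (fun j => Kf (curveSlots₂ i₀ i₁ (κ j))) (fun j => A₂ (κ j))
      (fun j => Φ₂ (κ j)) (fun j => ι₂ (κ j)) (fun j => θ₂ (κ j)) hAκ p).1]
    exact Submodule.subset_span ⟨hc, hH⟩
  have hle : (⨆ S ∈ pohlmannSetsAlg (K := fun j => Kf (curveSlots₂ i₀ i₁ (κ j))) (fun j => Φ₂ (κ j)) p,
      weightClassesAlg (fun j => A₂ (κ j)) (fun j => ι₂ (κ j)) (2 * p) S) ≤
      algebraicClasses (⨁ fun j => A₂ (κ j)).X p := by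
    refine iSup₂_le fun S hS => ?_
    exact key S (modelBalanced_of_isGaloisBalancedAlg hττ hk he_sign he_gal hΦ hΨ κ hS.2) p hS.1
  exact hle hmem

/-- **MAIN THEOREM (frame form, Weil-plane hypothesis displayed).  The Hodge conjecture for every power
`⨁_j A₂(κ j)` of `B₀ × E` — i.e. for `B₀^a × E^c`, all `a, c`, any order — GIVEN that the Weil plane
`W_k(B₀ × E) ⊗ ℂ` of the sixfold `(A₂ 0 × A₂ 1, ι₀(iδ) × ι₁(δ))` consists of algebraic classes.**  `k = Kf i₀` imaginary
quadratic with `τ(δ) = i√d`, `F = Kf i₁ ⊇ i(k)` read in a cyclic frame `e : Hom(F, ℂ) ≃ ℤ/10` (`he_sign`, `he_conj`,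
`he_gal`), `A₂ 0 ⊨ (F; {s | e s < 5})`, `A₂ 1 ⊨ (k; {τ})`.  The Weil plane hypothesis is Markman's theorem
(arXiv:2502.03415, Thm 1.5.1) for the SPLIT polarisations of the sixfold; nothing is claimed about it here.
[cite: Pohlmann1968, Thm 1] [cite: GaoUllmo2025, Thm 3.1] [cite: Milne2020HodgeClassesAV, Thm. 1]
[cite: Deligne1982HodgeCycles, Prop. 4.4 and §5 (c)] [cite: vanGeemen1994HodgeAV, 4.9] -/
theorem hodgeConjectureFor_biproduct_comp_of_weilPlane
    (h2 : Module.finrank ℚ (Kf i₀) = 2) (i : Kf i₀ →+* Kf i₁)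
    {δ : 𝓞 (Kf i₀)} {d : ℕ} (hd : 0 < d) (hτ : τ (δ : Kf i₀) = Complex.I * (Real.sqrt d : ℂ))
    (hA : ∀ j, IsCMTypeRealisation (Φ₂ j) (A₂ j) (ι₂ j) (θ₂ j))
    (e : (Kf i₁ →+* ℂ) ≃ ZMod 10)
    (he_sign : ∀ s : Kf i₁ →+* ℂ, s.comp i = τ ↔ (e s).val % 2 = 1)
    (he_conj : ∀ s : Kf i₁ →+* ℂ, e (ComplexEmbedding.conjugate s) = e s + 5)
    (he_gal : ∀ g : ZMod 10, ∃ ρ : ℂ ≃+* ℂ, ∀ s : Kf i₁ →+* ℂ, e ((ρ : ℂ →+* ℂ).comp s) = e s + g)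
    (hΦ : ∀ s : Kf i₁ →+* ℂ, s ∈ (Φ₂ 0).1 ↔ (e s).val < 5)
    (hΨ : ∀ σ : Kf i₀ →+* ℂ, σ ∈ (Φ₂ (0 : Fin 1).succ).1 ↔ σ = τ)
    (hW : weilClassesOf ((A₂ 0).prod (A₂ 1))
      (AbelianVariety.prodLift (AbelianVariety.fst (A₂ 0) (A₂ 1) ≫ ι₂ 0 (RingOfIntegers.mapRingHom i δ))
        (AbelianVariety.snd (A₂ 0) (A₂ 1) ≫ ι₂ 1 δ)) 3 d ≤
      algebraicClasses ((A₂ 0).prod (A₂ 1)).X 3) :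
    HodgeConjectureFor (⨁ fun j => A₂ (κ j)).dim (⨁ fun j => A₂ (κ j)).X :=
  have hττ : ComplexEmbedding.conjugate τ ≠ τ := CMThreefoldPair.conjugate_ne_of_apply_eq hd hτ
  have hk : ∀ σ : Kf i₀ →+* ℂ, σ = τ ∨ σ = ComplexEmbedding.conjugate τ := fun σ =>
    DihedralSexticPair.eq_or_eq_conjugate h2 hd hτ σ
  hodgeConjectureFor_biproduct_comp_of_generators κ hττ hk hA he_sign he_conj he_gal hΦ hΨ
    (fun b T hT => weightClassesAlg_le_algebraicClasses_of_image_eq_weil6 hττ hk he_sign hτ hW b T hT)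

/-- **The Hodge conjecture for every abelian variety dominated by a power `⨁_j A₂(κ j)`** (frame form, given the Weil
plane of the sixfold): every abelian variety isogenous to a product of copies of `B₀`, `E` and their abelian
subvarieties and quotients. [cite: MumfordAV1970, §19] [cite: vanGeemen1994HodgeAV, 3.7] -/
theorem hodgeConjectureFor_of_avDominatedBy_comp_of_weilPlane
    (h2 : Module.finrank ℚ (Kf i₀) = 2) (i : Kf i₀ →+* Kf i₁)
    {δ : 𝓞 (Kf i₀)} {d : ℕ} (hd : 0 < d) (hτ : τ (δ : Kf i₀) = Complex.I * (Real.sqrt d : ℂ))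
    (hA : ∀ j, IsCMTypeRealisation (Φ₂ j) (A₂ j) (ι₂ j) (θ₂ j))
    (e : (Kf i₁ →+* ℂ) ≃ ZMod 10)
    (he_sign : ∀ s : Kf i₁ →+* ℂ, s.comp i = τ ↔ (e s).val % 2 = 1)
    (he_conj : ∀ s : Kf i₁ →+* ℂ, e (ComplexEmbedding.conjugate s) = e s + 5)
    (he_gal : ∀ g : ZMod 10, ∃ ρ : ℂ ≃+* ℂ, ∀ s : Kf i₁ →+* ℂ, e ((ρ : ℂ →+* ℂ).comp s) = e s + g)
    (hΦ : ∀ s : Kf i₁ →+* ℂ, s ∈ (Φ₂ 0).1 ↔ (e s).val < 5)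
    (hΨ : ∀ σ : Kf i₀ →+* ℂ, σ ∈ (Φ₂ (0 : Fin 1).succ).1 ↔ σ = τ)
    (hW : weilClassesOf ((A₂ 0).prod (A₂ 1))
      (AbelianVariety.prodLift (AbelianVariety.fst (A₂ 0) (A₂ 1) ≫ ι₂ 0 (RingOfIntegers.mapRingHom i δ))
        (AbelianVariety.snd (A₂ 0) (A₂ 1) ≫ ι₂ 1 δ)) 3 d ≤
      algebraicClasses ((A₂ 0).prod (A₂ 1)).X 3)
    {B : AbelianVariety ℂ} (hB : Domination.AVDominatedBy B (⨁ fun j => A₂ (κ j))) :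
    HodgeConjectureFor B.dim B.X :=
  Domination.hodgeConjectureFor_of_avDominatedBy
    (hodgeConjectureFor_biproduct_comp_of_weilPlane κ h2 i hd hτ hA e he_sign he_conj he_gal hΦ hΨ hW) hB

end Assembly

end Summit.HodgeConjecture.CorCM.DecicCurveFivefold

end
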